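import Mathlib
import HarnessLib

/-!
# `NoHeavyLowerTail` (crux stmt-CriticalPhenomena-4575), antithetic vdBHK programme: ROOT LEAVES ARE FREE for the TYPED
# per-tree inequality `(***)⁺⁺` (the typed root-leaf step)

Support file (seat `prim-ineq-gen-7` gen 42; `--supports stmt-CriticalPhenomena-4575`).  Nothing is asserted about the crux; no `sorry`,
no definitions.  Memo: run/shared/lean/prim/prim-ineq-gen-7/FINDING-ROOTLEAF-g42.md §1–§3.

CONTEXT.  The reduction `CONJECTURE (***) ⟹ RAA for unicyclic graphs` (memo FINDING-TREEBLOCK-g25) asks, for a rooted tree `(T,v)` with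
colouring poset `F_v` (antitone involution `ι`, route sets `K(ρ)`), that for all up-sets `a, a', b, b'` of `F_v`
  `t(a,a',b,b') + #{ρ : cert₁(ρ) ∨ cert₂(ρ)} ≥ 0`,  `t = Σ_ρ a(ρ)(b(ρ) − b'(ιρ)) + a'(ρ)(b'(ρ) − b(ιρ))`,
  `cert₁(ρ) = [a ∩ K(ρ) ≠ ∅][ρ ∉ a'][ρ ∉ b][b' ∩ K(ρ) ≠ ∅]`, `cert₂(ρ) = [ρ ∉ a][a' ∩ K(ρ) ≠ ∅][b ∩ K(ρ) ≠ ∅][ρ ∉ b']`.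
Gen 42 shows (memo §2: LEMMA D2 + the CONSISTENCY LEMMA of g25) that for cycle length `≥ 3` the reduction only needs the WEAKER TYPED form
  `(***)⁺⁺ :  t(a,a',b,b') + #{ρ : cert₁(ρ)} + #{ρ : cert₂(ρ)} ≥ 0`,
and (memo §1) that `(***)⁺⁺` is inherited when a LEAF `ℓ` is attached AT THE ROOT: `F_v(T ∨ ℓ) = F_v(T) × {red < blue}` with
`ι⁺ = ι × swap` and `K⁺(ρ,c) = K(ρ) × ↓c̄`; an up-set quadruple `Y` of `F_v(T ∨ ℓ)` is a pair of quadruples (red fibre `R ⊆` blue fibre `B`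
coordinatewise); its route indicators at `(ρ, red)` are those of `B`, at `(ρ, blue)` those of `R`; and (exact identity)
  `val⁺⁺_{T∨ℓ}(Y) = t(q₁) + t(q₂) + Σ_{types} [#cert(routes B, members R) + #cert(routes R, members B)]`
for the CROSSED quadruples `q₁ = (B_a, R_{a'}, B_b, R_{b'})`, `q₂ = (R_a, B_{a'}, R_b, B_{b'})`, whence
  `val⁺⁺_{T∨ℓ}(Y) ≥ val⁺⁺_T(q₁) + val⁺⁺_T(q₂)`   (THEOREM RL⁺⁺: `(***)⁺⁺(T) ⟹ (***)⁺⁺(T ∨ s·P₁)` for all `s`).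
This file is the abstract kernel of that step.  Positions form any finite type `α`, `ι : α → α` is ANY map, memberships and route
indicators are finsets with the eight inclusions `R ⊆ B`, `KR ⊆ KB`, and the indicator weight `χ : Finset α → α → ℤ` is ARBITRARY (the
quadratic parts cancel termwise); a typed certificate set 'both routes, neither membership' is written `(K₁ ∩ K₂) \ (m₁ ∪ m₂)`
(type 1 of `(a,a',b,b')`: `(Ka ∩ Kb') \ (a' ∪ b)`; type 2: `(Ka' ∩ Kb) \ (a ∪ b')`).
* `AntitheticRootLeaf.route_pair` — THE PER-TYPE INJECTION: for `Xs ⊆ Xb, Ys ⊆ Yb, Us ⊆ Ub, Vs ⊆ Vb`,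
  `#((Xb ∩ Ys) \ (Us ∪ Vb)) + #((Xs ∩ Yb) \ (Ub ∪ Vs)) ≤ #((Xb ∩ Yb) \ (Us ∪ Vs)) + #((Xs ∩ Ys) \ (Ub ∪ Vb))`
  (the two crossed certificates land in the 'big routes / small members' set, and in the 'small routes / big members' set when both are
  present: `#A + #B = #(A ∪ B) + #(A ∩ B)`);
* `AntitheticRootLeaf.tq_fibre` — the quadratic part of `F_v(T) × {red<blue}` is EXACTLY `t(q₁) + t(q₂)` (termwise `ring`);
* `AntitheticRootLeaf.typed_root_leaf_step` — `val⁺⁺(Y) ≥ val⁺⁺(q₁) + val⁺⁺(q₂)`; `typed_root_leaf_nonneg` — `(***)⁺⁺(T) ⟹ (***)⁺⁺(T ∨ ℓ)`.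
The untyped `(***)` is NOT inherited this way: `cert₁(q₁)` and `cert₂(q₂)` can both land on the same position `(ρ, red)` (18 local
configurations, memo §1) — the reason 'root leaves are free' resisted the certificate machines of gens 39–41.
-/

namespace Summit.CriticalPhenomena.PercolationContinuityZ3.Theorems

open Finset

namespace AntitheticRootLeaf

variable {α : Type*} [DecidableEq α]

/-- **PER-TYPE INJECTION (one certificate type).**  For routes `Xs ⊆ Xb`, `Ys ⊆ Yb` and memberships `Us ⊆ Ub`, `Vs ⊆ Vb`
(small fibre `⊆` big fibre): `#((Xb ∩ Ys) \ (Us ∪ Vb)) + #((Xs ∩ Yb) \ (Ub ∪ Vs)) ≤ #((Xb ∩ Yb) \ (Us ∪ Vs)) + #((Xs ∩ Ys) \ (Ub ∪ Vb))`.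
[this work] -/
theorem route_pair (Xs Xb Ys Yb Us Ub Vs Vb : Finset α)
    (hX : Xs ⊆ Xb) (hY : Ys ⊆ Yb) (hU : Us ⊆ Ub) (hV : Vs ⊆ Vb) :
    ((Xb ∩ Ys) \ (Us ∪ Vb)).card + ((Xs ∩ Yb) \ (Ub ∪ Vs)).card
      ≤ ((Xb ∩ Yb) \ (Us ∪ Vs)).card + ((Xs ∩ Ys) \ (Ub ∪ Vb)).card := by
  set A := (Xb ∩ Ys) \ (Us ∪ Vb) with hA
  set B := (Xs ∩ Yb) \ (Ub ∪ Vs) with hB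
  have hAC : A ∪ B ⊆ (Xb ∩ Yb) \ (Us ∪ Vs) := by
    intro r hr
    simp only [hA, hB, mem_union, mem_sdiff, mem_inter, not_or] at hr ⊢
    rcases hr with h | h
    · exact ⟨⟨h.1.1, hY h.1.2⟩, h.2.1, fun hv => h.2.2 (hV hv)⟩
    · exact ⟨⟨hX h.1.1, h.1.2⟩, fun hu => h.2.1 (hU hu), h.2.2⟩
  have hBD : A ∩ B ⊆ (Xs ∩ Ys) \ (Ub ∪ Vb) := by
    intro r hr
    simp only [hA, hB, mem_inter, mem_sdiff, mem_union, not_or] at hr ⊢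
    exact ⟨⟨hr.2.1.1, hr.1.1.2⟩, hr.2.2.1, hr.1.2.2⟩
  have h := Finset.card_union_add_card_inter A B
  have h1 := Finset.card_le_card hAC
  have h2 := Finset.card_le_card hBD
  omega

omit [DecidableEq α] in
/-- **Fibre identity.**  The quadratic part of the per-tree functional on `F_v(T) × {red<blue}` (`ι⁺ = ι × swap`; position `(r, red)`
carries the red-fibre memberships `R` with partner `(ι r, blue)`, position `(r, blue)` the blue-fibre memberships `B` with partner
`(ι r, red)`) equals `t(q₁) + t(q₂)` for the crossed quadruples `q₁ = (B_a,R_{a'},B_b,R_{b'})`, `q₂ = (R_a,B_{a'},R_b,B_{b'})` — termwise,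
for any map `ι` and any weight `χ`. [this work] -/
theorem tq_fibre (s : Finset α) (ι : α → α) (χ : Finset α → α → ℤ) (Ra Ra' Rb Rb' Ba Ba' Bb Bb' : Finset α) :
    ∑ r ∈ s, ((χ Ra r * (χ Rb r - χ Bb' (ι r)) + χ Ra' r * (χ Rb' r - χ Bb (ι r)))
        + (χ Ba r * (χ Bb r - χ Rb' (ι r)) + χ Ba' r * (χ Bb' r - χ Rb (ι r))))
      = ∑ r ∈ s, (χ Ba r * (χ Bb r - χ Rb' (ι r)) + χ Ra' r * (χ Rb' r - χ Bb (ι r)))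
        + ∑ r ∈ s, (χ Ra r * (χ Rb r - χ Bb' (ι r)) + χ Ba' r * (χ Bb' r - χ Rb (ι r))) := by
  rw [← Finset.sum_add_distrib]
  refine Finset.sum_congr rfl fun r _ => ?_
  ring

/-- **TYPED ROOT-LEAF STEP.**  `val⁺⁺_{T∨ℓ}(Y) ≥ val⁺⁺_T(q₁) + val⁺⁺_T(q₂)`: left, the typed values of the crossed quadruples
`q₁ = (B_a,R_{a'},B_b,R_{b'})` (routes `KB_a, KR_{a'}, KB_b, KR_{b'}`) and `q₂ = (R_a,B_{a'},R_b,B_{b'})` (routes `KR_a, KB_{a'}, KR_b, KB_{b'}`);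
right, the typed value of the up-set quadruple of `F_v(T) × {red<blue}` with fibres `R ⊆ B` and route indicators `KR ⊆ KB`
(at `(r, red)`: routes of `B`, members of `R`; at `(r, blue)`: routes of `R`, members of `B`).  Any weight `χ`, any map `ι`, any
position range `s`. [this work] -/
theorem typed_root_leaf_step (s : Finset α) (ι : α → α) (χ : Finset α → α → ℤ)
    (Ra Ra' Rb Rb' Ba Ba' Bb Bb' KRa KRa' KRb KRb' KBa KBa' KBb KBb' : Finset α)
    (ha : Ra ⊆ Ba) (ha' : Ra' ⊆ Ba') (hb : Rb ⊆ Bb) (hb' : Rb' ⊆ Bb')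
    (ka : KRa ⊆ KBa) (ka' : KRa' ⊆ KBa') (kb : KRb ⊆ KBb) (kb' : KRb' ⊆ KBb') :
    ( (∑ r ∈ s, (χ Ba r * (χ Bb r - χ Rb' (ι r)) + χ Ra' r * (χ Rb' r - χ Bb (ι r))))
        + (((KBa ∩ KRb') \ (Ra' ∪ Bb)).card : ℤ) + (((KRa' ∩ KBb) \ (Ba ∪ Rb')).card : ℤ) )       -- val⁺⁺(q₁)
    + ( (∑ r ∈ s, (χ Ra r * (χ Rb r - χ Bb' (ι r)) + χ Ba' r * (χ Bb' r - χ Rb (ι r))))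
        + (((KRa ∩ KBb') \ (Ba' ∪ Rb)).card : ℤ) + (((KBa' ∩ KRb) \ (Ra ∪ Bb')).card : ℤ) )       -- val⁺⁺(q₂)
    ≤ (∑ r ∈ s, ((χ Ra r * (χ Rb r - χ Bb' (ι r)) + χ Ra' r * (χ Rb' r - χ Bb (ι r)))
          + (χ Ba r * (χ Bb r - χ Rb' (ι r)) + χ Ba' r * (χ Bb' r - χ Rb (ι r)))))                  -- t on F_v(T) × {red<blue}
      + ((((KBa ∩ KBb') \ (Ra' ∪ Rb)).card : ℤ) + (((KBa' ∩ KBb) \ (Ra ∪ Rb')).card : ℤ))            -- (r, red): routes B, members R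
      + ((((KRa ∩ KRb') \ (Ba' ∪ Bb)).card : ℤ) + (((KRa' ∩ KRb) \ (Ba ∪ Bb')).card : ℤ)) := by      -- (r, blue): routes R, members B
  have h1 := route_pair KRa KBa KRb' KBb' Ra' Ba' Rb Bb ka kb' ha' hb      -- type 1
  have h2 := route_pair KRa' KBa' KRb KBb Ra Ba Rb' Bb' ka' kb ha hb'      -- type 2
  rw [tq_fibre]
  linarith

/-- **COROLLARY (`(***)⁺⁺(T) ⟹ (***)⁺⁺(T ∨ ℓ)`).**  If the typed values of `T` at the two crossed quadruples are nonnegative then the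
typed value of the up-set quadruple of `T ∨ ℓ` is nonnegative. [this work] -/
theorem typed_root_leaf_nonneg (s : Finset α) (ι : α → α) (χ : Finset α → α → ℤ)
    (Ra Ra' Rb Rb' Ba Ba' Bb Bb' KRa KRa' KRb KRb' KBa KBa' KBb KBb' : Finset α)
    (ha : Ra ⊆ Ba) (ha' : Ra' ⊆ Ba') (hb : Rb ⊆ Bb) (hb' : Rb' ⊆ Bb')
    (ka : KRa ⊆ KBa) (ka' : KRa' ⊆ KBa') (kb : KRb ⊆ KBb) (kb' : KRb' ⊆ KBb')
    (hq₁ : 0 ≤ (∑ r ∈ s, (χ Ba r * (χ Bb r - χ Rb' (ι r)) + χ Ra' r * (χ Rb' r - χ Bb (ι r))))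
        + (((KBa ∩ KRb') \ (Ra' ∪ Bb)).card : ℤ) + (((KRa' ∩ KBb) \ (Ba ∪ Rb')).card : ℤ))
    (hq₂ : 0 ≤ (∑ r ∈ s, (χ Ra r * (χ Rb r - χ Bb' (ι r)) + χ Ba' r * (χ Bb' r - χ Rb (ι r))))
        + (((KRa ∩ KBb') \ (Ba' ∪ Rb)).card : ℤ) + (((KBa' ∩ KRb) \ (Ra ∪ Bb')).card : ℤ)) :
    0 ≤ (∑ r ∈ s, ((χ Ra r * (χ Rb r - χ Bb' (ι r)) + χ Ra' r * (χ Rb' r - χ Bb (ι r)))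
          + (χ Ba r * (χ Bb r - χ Rb' (ι r)) + χ Ba' r * (χ Bb' r - χ Rb (ι r)))))
      + ((((KBa ∩ KBb') \ (Ra' ∪ Rb)).card : ℤ) + (((KBa' ∩ KBb) \ (Ra ∪ Rb')).card : ℤ))
      + ((((KRa ∩ KRb') \ (Ba' ∪ Bb)).card : ℤ) + (((KRa' ∩ KRb) \ (Ba ∪ Bb')).card : ℤ)) := by
  have h := typed_root_leaf_step s ι χ Ra Ra' Rb Rb' Ba Ba' Bb Bb' KRa KRa' KRb KRb' KBa KBa' KBb KBb'
    ha ha' hb hb' ka ka' kb kb'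
  linarith

end AntitheticRootLeaf

end Summit.CriticalPhenomena.PercolationContinuityZ3.Theorems
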